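import Summits.Ventures.Crystal3D.Theorems.StickyWulffConstantNoReconstructionGainExactLocalReplication
import Summits.Ventures.Crystal3D.Theorems.StickyWulffConstantNoReconstructionGainOffRegistryDegenerate
import HarnessLib

/-!
# No criminal has a contact-3-degenerate off-lattice part (line `replication-exactness`)

HONEST FRAMING. Part of the venture `Summits/Ventures/Crystal3D` (cell `crystal3d-full`), supports the
crux `NoReconstructionGain` (stmt-Ventures-19144, route `route-Ventures-StickyWulffConstant`), line
`replication-exactness` (lead wulff-p1 g18).  Third instantiation of the LOCAL replication licence
`not_isCriminal_of_localAtom` (`…ExactLocalReplication`), with the landed rung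
`offRegistryThreeDegenerate_adhesion` (`…OffRegistryDegenerate`: if the off-lattice film balls form a
contact-3-degenerate set — every nonempty sub-configuration has a ball with at most three partners in
it — the film gains nothing, `C = 0`, every normal).  Hereditary degeneracy of the off-lattice part
is a local film property: translation invariant (translate the sub-configuration back) and inherited
by far unions (restrict the sub-configuration to one copy; partners at distance `1` stay in the copy).

* `not_isCriminal_of_threeDegenerate_offLattice` — such a film is not a criminal, on any face;
* `not_isCriminal_of_offDegree_le_three` — in particular a film each of whose off-lattice balls
  touches at most three off-lattice film balls (ad-atoms, ad-dimers, chains, trees, honeycomb rafts …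
  on top of an arbitrary registry part) is never a criminal.

WHAT THIS IS NOT: denser off-lattice parts are not covered; the crux is not moved; rung F-C1 not
moved.
-/

noncomputable section

namespace Summit.Ventures.Crystal3D.Theorems

open Summit.Ventures.Crystal3D
open Literature.MathematicalPhysics.StatisticalMechanics (fccStacking contactDeficiency)
open scoped InnerProductSpace
open Finset

/-- Translation invariance of "the off-lattice part is contact-3-degenerate". -/
private theorem threeDegenerate_translate {F : Finset (EuclideanSpace ℝ (Fin 3))}
    (hF : ∀ S ⊆ F, (∀ x ∈ S, x ∉ fccStacking 1 (Real.sqrt (2 / 3))) → S.Nonempty →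
      ∃ q ∈ S, (S.filter fun x => dist q x = 1).card ≤ 3)
    {t : EuclideanSpace ℝ (Fin 3)} (ht : t ∈ fccStacking 1 (Real.sqrt (2 / 3))) :
    ∀ S ⊆ F.image (fun q => q + t), (∀ x ∈ S, x ∉ fccStacking 1 (Real.sqrt (2 / 3))) → S.Nonempty →
      ∃ q ∈ S, (S.filter fun x => dist q x = 1).card ≤ 3 := by
  classical
  intro S hS hoff hne
  set S' := S.image fun x => x - t with hS'
  have hS'F : S' ⊆ F := by
    intro y hy
    obtain ⟨x, hx, rfl⟩ := Finset.mem_image.1 hy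
    obtain ⟨q, hq, hqx⟩ := Finset.mem_image.1 (hS hx)
    rw [← hqx, add_sub_cancel_right]; exact hq
  have hoff' : ∀ y ∈ S', y ∉ fccStacking 1 (Real.sqrt (2 / 3)) := by
    intro y hy hyΛ
    obtain ⟨x, hx, rfl⟩ := Finset.mem_image.1 hy
    have := fcc_add_site_mem hyΛ ht
    rw [sub_add_cancel] at this
    exact hoff x hx this
  obtain ⟨q', hq', hcard⟩ := hF S' hS'F hoff' (hne.image _)
  obtain ⟨x₀, hx₀, rfl⟩ := Finset.mem_image.1 hq'
  refine ⟨x₀, hx₀, le_trans ?_ hcard⟩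
  rw [← Finset.card_image_of_injective (S.filter fun x => dist x₀ x = 1) (sub_left_injective (b := t))]
  refine Finset.card_le_card fun y hy => ?_
  obtain ⟨x, hx, rfl⟩ := Finset.mem_image.1 hy
  rw [Finset.mem_filter] at hx ⊢
  refine ⟨Finset.mem_image.2 ⟨x, hx.1, rfl⟩, ?_⟩
  rw [dist_eq_norm] at hx ⊢
  have e : x₀ - t - (x - t) = x₀ - x := by abel
  rw [e]; exact hx.2

/-- Far unions inherit "the off-lattice part is contact-3-degenerate". -/
private theorem threeDegenerate_biUnion (T : Finset (EuclideanSpace ℝ (Fin 3)))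
    (G : EuclideanSpace ℝ (Fin 3) → Finset (EuclideanSpace ℝ (Fin 3)))
    (hG : ∀ t ∈ T, ∀ S ⊆ G t, (∀ x ∈ S, x ∉ fccStacking 1 (Real.sqrt (2 / 3))) → S.Nonempty →
      ∃ q ∈ S, (S.filter fun x => dist q x = 1).card ≤ 3)
    (hfar : ∀ t ∈ T, ∀ t' ∈ T, t ≠ t' → ∀ y ∈ G t, ∀ y' ∈ G t', 1 < dist y y') :
    ∀ S ⊆ T.biUnion G, (∀ x ∈ S, x ∉ fccStacking 1 (Real.sqrt (2 / 3))) → S.Nonempty →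
      ∃ q ∈ S, (S.filter fun x => dist q x = 1).card ≤ 3 := by
  classical
  intro S hS hoff hne
  obtain ⟨x, hx⟩ := hne
  obtain ⟨t₀, ht₀, hxt₀⟩ := Finset.mem_biUnion.1 (hS hx)
  set S' := S.filter fun y => y ∈ G t₀ with hS'
  have hS'G : S' ⊆ G t₀ := fun y hy => (Finset.mem_filter.1 hy).2
  have hoff' : ∀ y ∈ S', y ∉ fccStacking 1 (Real.sqrt (2 / 3)) :=
    fun y hy => hoff y (Finset.mem_filter.1 hy).1
  obtain ⟨q, hq, hcard⟩ := hG t₀ ht₀ S' hS'G hoff' ⟨x, Finset.mem_filter.2 ⟨hx, hxt₀⟩⟩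
  have hqS : q ∈ S := (Finset.mem_filter.1 hq).1
  have hqG : q ∈ G t₀ := (Finset.mem_filter.1 hq).2
  refine ⟨q, hqS, le_trans (Finset.card_le_card fun y hy => ?_) hcard⟩
  rw [Finset.mem_filter] at hy ⊢
  obtain ⟨t, ht, hyt⟩ := Finset.mem_biUnion.1 (hS hy.1)
  have htt : t₀ = t := by
    by_contra hne
    have := hfar t₀ ht₀ t ht hne q hqG y hyt
    rw [hy.2] at this
    exact lt_irrefl _ this
  subst htt
  exact ⟨Finset.mem_filter.2 ⟨hy.1, hyt⟩, hy.2⟩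

/-- **No criminal has a contact-3-degenerate off-lattice part.**  If every nonempty set of
off-lattice balls of the film contains a ball with at most three partners in the set (the registry
part of the film is arbitrary), the film is not a criminal, on any face. -/
theorem not_isCriminal_of_threeDegenerate_offLattice {ν : EuclideanSpace ℝ (Fin 3)} (hν : ‖ν‖ = 1)
    {s : ℝ} {Q : Finset (EuclideanSpace ℝ (Fin 3))}
    (hdeg : ∀ S ⊆ Q, (∀ x ∈ S, x ∉ fccStacking 1 (Real.sqrt (2 / 3))) → S.Nonempty →
      ∃ q ∈ S, (S.filter fun x => dist q x = 1).card ≤ 3) :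
    ¬ IsCriminal ν s Q := by
  obtain ⟨R, C, hR, h⟩ := offRegistryThreeDegenerate_adhesion
  exact not_isCriminal_of_localAtom
    (Pf := fun F => ∀ S ⊆ F, (∀ x ∈ S, x ∉ fccStacking 1 (Real.sqrt (2 / 3))) → S.Nonempty →
      ∃ q ∈ S, (S.filter fun x => dist q x = 1).card ≤ 3) (C := C)
    (fun F hF t ht => threeDegenerate_translate hF ht) threeDegenerate_biUnion hν hR
    (fun ρ hρ X P hpack hPX hP hPf _ => h ν hν ρ hρ X P hpack hPX hP hPf) hdeg

open scoped Classical in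
/-- **No criminal with a sparse overlayer.**  A film each of whose off-lattice balls touches at most
three off-lattice film balls is not a criminal, on any face. -/
theorem not_isCriminal_of_offDegree_le_three {ν : EuclideanSpace ℝ (Fin 3)} (hν : ‖ν‖ = 1) {s : ℝ}
    {Q : Finset (EuclideanSpace ℝ (Fin 3))}
    (hdeg : ∀ q ∈ Q, q ∉ fccStacking 1 (Real.sqrt (2 / 3)) →
      (Q.filter fun x => x ∉ fccStacking 1 (Real.sqrt (2 / 3)) ∧ dist q x = 1).card ≤ 3) :
    ¬ IsCriminal ν s Q := by
  refine not_isCriminal_of_threeDegenerate_offLattice hν fun S hS hoff hne => ?_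
  obtain ⟨q, hq⟩ := hne
  refine ⟨q, hq, le_trans (Finset.card_le_card fun x hx => ?_) (hdeg q (hS hq) (hoff q hq))⟩
  rw [Finset.mem_filter] at hx ⊢
  exact ⟨hS hx.1, hoff x hx.1, hx.2⟩

end Summit.Ventures.Crystal3D.Theorems

end
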